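import Summits.Ventures.PercRepro.GenQHallCore
import Summits.Ventures.PercRepro.GenQFrameDiagCore
import Summits.Ventures.PercRepro.RLSRulePlus

/-!
# PercRepro — the open layers on CORE matroids (`OpenLayersCore`) feed the same consumers (night-4, gen 2;
RULING (rm)(4))

`OpenLayers q` (`GenQOpenLayers.lean`) is typed over SIMPLE matroids.  night-3's `Core M p` (`RLSRulePlus.lean`:
simple, rank `p`, coloop-free, every point with an `e`-free partition) is what the q = 3 / q = 4 lanes prove their
per-flat statements on, and the engine's bound «the flats of a Core matroid are small» lives there.  Since
`hall_core_of_flats` / `rls_succ_succ_of_flats` only need the balances on the flats of the matroid AT HAND, the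
Core-restricted layers feed them verbatim:

* `OpenLayersCore q` — `OpenLayers q` with `Core M (q + 2)` in place of `Simple M`;
* `openLayersCore_of_openLayers`: `OpenLayers q → OpenLayersCore q`;
* `hall_core_of_openLayersCore`: `OpenLayersCore q → Core M (q + 2) → Hall M (q + 2) q (Φ(q + 2, q))` (`q ≥ 3`);
* `rls_core_of_openLayersCore`: `OpenLayersCore q → Core M (q + 2) → RLS M (q + 2) q` (`q ≥ 3`);
* `rls_succ_succ_of_openLayersCore`: the row `(q + 2, q)` on EVERY finite matroid from `OpenLayersCore q'` for
  `5 ≤ q' ≤ q` — the diagonal wrapper `rls_diag_core` (`GenQFrameDiagCore.lean`) descends to the full core, so the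
  Core-typed layers suffice for the landing, not only for the core;
* `openLayers_four` / `openLayersCore_four`: level `4` is CLOSED (`residueBelowFlat_four_of_typeThree` with the landed
  `typeThreeSmall_holds`, `twentyOnePrime_holds`), so the first open level is `5`;
* `SevenFiveLayersCore` — `SevenFiveLayers` on Core matroids of rank `7`: on every rank-`5` flat in `𝔉_5` the type-`2`
  balance when `g ≤ 10`, and the type-`3` and type-`4` balances; `rls_seven_five_of_layersCore : SevenFiveLayersCore →
  ∀ M, RLS M 7 5` — the exact kernel gap of the first open row, on the core only.

Imports `GenQHallCore`, `GenQFrameDiagCore` and `RLSRulePlus` (for `Core`).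
-/

namespace PercRepro.GenQ

open Finset ThmH PerFlat SixFour ThmN NightThree

/-- **The open layers of level `q` on Core matroids**: `OpenLayers q` with `Core M (q + 2)` for `Simple M`. -/
def OpenLayersCore (q : ℕ) : Prop :=
  ∀ {β : Type} [DecidableEq β] (M : Matroid β) [M.Finite] (G : Finset β), Core M (q + 2) → G ∈ flatsQ M q →
    TwoHyp M G q →
      (6 ≤ q → q + 2 ≤ G.card → (G.card - q) * (q + 3) + 1 < q * q → 0 ≤ Jq M G q 1) ∧
      ((G.card - q) * (G.card - q + 3) < 12 * (q - 1) → 0 ≤ Jq M G q 2) ∧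
      (∀ t, 3 ≤ t → t + 1 ≤ q → 0 ≤ Jq M G q t)

/-- A Core matroid is simple in the sense of `ThmH.Simple`. -/
theorem simple_of_core {α : Type} {M : Matroid α} {p : ℕ} (h : Core M p) : Simple M := h.1

/-- `OpenLayers q` restricts to the Core layers. -/
theorem openLayersCore_of_openLayers {q : ℕ} (h : OpenLayers q) : OpenLayersCore q := by
  intro β _ M _ G hc hG hF
  exact h M G (simple_of_core hc) hG hF

/-- **The Hall condition on a Core matroid from its open layers** (`q ≥ 3`). -/
theorem hall_core_of_openLayersCore {γ : Type} [DecidableEq γ] {M : Matroid γ} [M.Finite] (q : ℕ) (hq : 3 ≤ q)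
    (h : OpenLayersCore q) (hc : Core M (q + 2)) : Hall M (q + 2) q (phiK (q + 2) q) := by
  have hs : Simple M := simple_of_core hc
  have hflats : ∀ G ∈ flatsQ M q, ∀ t, t + 1 ≤ q → 0 ≤ Jq M G q t := by
    intro G hG t ht
    have hGg : G ⊆ gr M := (mem_flatsQ.1 hG).1
    have hr : M.eRk (G : Set γ) = (q : ℕ∞) := (mem_flatsQ.1 hG).2.2
    by_cases hF : TwoHyp M G q
    · obtain ⟨h1, h2, h3⟩ := h M G hc hG hF
      rcases t with _ | _ | _ | t
      · exact Jq_zero_nonneg hGg q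
      · by_cases hq5 : q ≤ 5
        · exact Jq_one_nonneg_of_le_five hs hGg hr (by omega) hq5
        · by_cases hg : G.card ≤ q + 1
          · exact Jq_one_nonneg_of_card_le_succ hs hGg hr (by omega) hg
          · by_cases hthr : q * q ≤ (G.card - q) * (q + 3) + 1
            · exact Jq_one_nonneg hs hGg hr (by omega) hthr
            · exact h1 (by omega) (by omega) (by omega)
      · by_cases hthr : 12 * (q - 1) ≤ (G.card - q) * (G.card - q + 3)
        · exact Jq_two_nonneg' hs hGg hr (by omega) hthr
        · exact h2 (by omega)
      · exact h3 (t + 3) (by omega) ht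
    · exact Jq_nonneg_of_not_twoHyp hGg hr hF (by omega)
  exact hall_core_of_flats q (by omega) (le_of_eq hc.2.1.symm) (fun _ => hc.2.2.1) hflats

/-- **The row `(q + 2, q)` on a Core matroid from its open layers** (`q ≥ 3`). -/
theorem rls_core_of_openLayersCore {γ : Type} [DecidableEq γ] {M : Matroid γ} [M.Finite] (q : ℕ) (hq : 3 ≤ q)
    (h : OpenLayersCore q) (hc : Core M (q + 2)) : RLS M (q + 2) q := by
  have hs : Simple M := simple_of_core hc
  have hflats : ∀ G ∈ flatsQ M q, ∀ t, t + 1 ≤ q → 0 ≤ Jq M G q t := by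
    intro G hG t ht
    have hGg : G ⊆ gr M := (mem_flatsQ.1 hG).1
    have hr : M.eRk (G : Set γ) = (q : ℕ∞) := (mem_flatsQ.1 hG).2.2
    by_cases hF : TwoHyp M G q
    · obtain ⟨h1, h2, h3⟩ := h M G hc hG hF
      rcases t with _ | _ | _ | t
      · exact Jq_zero_nonneg hGg q
      · by_cases hq5 : q ≤ 5
        · exact Jq_one_nonneg_of_le_five hs hGg hr (by omega) hq5
        · by_cases hg : G.card ≤ q + 1
          · exact Jq_one_nonneg_of_card_le_succ hs hGg hr (by omega) hg
          · by_cases hthr : q * q ≤ (G.card - q) * (q + 3) + 1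
            · exact Jq_one_nonneg hs hGg hr (by omega) hthr
            · exact h1 (by omega) (by omega) (by omega)
      · by_cases hthr : 12 * (q - 1) ≤ (G.card - q) * (G.card - q + 3)
        · exact Jq_two_nonneg' hs hGg hr (by omega) hthr
        · exact h2 (by omega)
      · exact h3 (t + 3) (by omega) ht
    · exact Jq_nonneg_of_not_twoHyp hGg hr hF (by omega)
  exact rls_succ_succ_of_flats q (by omega) M (le_of_eq hc.2.1.symm) (fun _ => hc.2.2.1) hflats

/-- **The row `(q + 2, q)` on EVERY finite matroid from the Core-typed open layers of the levels `5 … q`** (`q ≥ 3`):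
level `3` is Theorem O (`rls_five_three_b`), level `4` is the `(6, 4)` chain through `rls_diag`, and every level
`q' ≥ 5` is `rls_core_of_openLayersCore` on the full core that `rls_diag_core` descends to. -/
theorem rls_succ_succ_of_openLayersCore {α : Type} [DecidableEq α] (q : ℕ) (hq : 3 ≤ q)
    (h : ∀ q', 5 ≤ q' → q' ≤ q → OpenLayersCore q') : ∀ (M : Matroid α) [M.Finite], RLS M (q + 2) q := by
  induction q, hq using Nat.le_induction with
  | base => exact fun M _ => rls_five_three_b M
  | succ k hk ih =>
    have hprev : ∀ (M : Matroid α) [M.Finite], RLS M (k + 2) k :=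
      ih (fun q' h5 hq' => h q' h5 (by omega))
    by_cases h4 : k + 1 = 4
    · have hres' : PerFlatResidueBelowFlat (k + 1) := by
        rw [h4]
        exact residueBelowFlat_four_of_typeThree typeThreeSmall_holds twentyOnePrime_holds
      exact rls_diag k hprev (fun M _ hs hR hcol =>
        rls_succ_succ_of_residueBelowFlat (k + 1) (by omega) hres' M hs (by rw [hR]) (fun _ => hcol))
    · exact rls_diag_core k hprev (fun M _ hs hR hcol hfree =>
        rls_core_of_openLayersCore (k + 1) (by omega) (h (k + 1) (by omega) le_rfl) ⟨hs, hR, hcol, hfree⟩)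

/-- **The open layers of `(7, 5)` on Core matroids of rank `7`**: on every rank-`5` flat `G ∈ 𝔉_5`, the type-`2`
balance when `G` has at most `10` points, and the type-`3` and type-`4` balances. -/
def SevenFiveLayersCore : Prop :=
  ∀ {β : Type} [DecidableEq β] (M : Matroid β) [M.Finite] (G : Finset β), Core M 7 → G ∈ flatsQ M 5 →
    TwoHyp M G 5 → (G.card ≤ 10 → 0 ≤ Jq M G 5 2) ∧ 0 ≤ Jq M G 5 3 ∧ 0 ≤ Jq M G 5 4

/-- `SevenFiveLayers` restricts to `SevenFiveLayersCore`. -/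
theorem sevenFiveLayersCore_of_sevenFiveLayers (h : SevenFiveLayers) : SevenFiveLayersCore := by
  intro β _ M _ G hc hG hF
  exact h M G (simple_of_core hc) hG hF

/-- `SevenFiveLayersCore` is `OpenLayersCore 5` (the type-`1` clause is vacuous, the type-`2` window is `g ≤ 10`). -/
theorem openLayersCore_five_of_sevenFiveLayersCore (h : SevenFiveLayersCore) : OpenLayersCore 5 := by
  intro β _ M _ G hc hG hF
  obtain ⟨h2, h3, h4⟩ := h M G hc hG hF
  refine ⟨fun h6 => absurd h6 (by norm_num), ?_, ?_⟩
  · intro hwin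
    apply h2
    by_contra hg
    push Not at hg
    have h6 : 6 ≤ G.card - 5 := by omega
    have h9 : 9 ≤ G.card - 5 + 3 := by omega
    have := Nat.mul_le_mul h6 h9
    omega
  · intro t ht3 ht
    have : t = 3 ∨ t = 4 := by omega
    rcases this with rfl | rfl
    · exact h3
    · exact h4

/-- **C-025 at `(7, 5)` on every finite matroid from the Core-typed layers of level `5` alone.** -/
theorem rls_seven_five_of_layersCore {α : Type} [DecidableEq α] (h : SevenFiveLayersCore) (M : Matroid α)
    [M.Finite] : RLS M 7 5 := by
  refine rls_succ_succ_of_openLayersCore 5 (by norm_num) ?_ M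
  intro q' hq'5 hq'
  obtain rfl : q' = 5 := by omega
  exact openLayersCore_five_of_sevenFiveLayersCore h

/-- **C-029 at `(7, 5)` on the core from the Core-typed layers of level `5`**: the Hall condition at `Φ(7, 5)` on every
Core matroid of rank `7`. -/
theorem hall_seven_five_core_of_layersCore {γ : Type} [DecidableEq γ] {M : Matroid γ} [M.Finite]
    (h : SevenFiveLayersCore) (hc : Core M 7) : Hall M 7 5 (phiK 7 5) :=
  hall_core_of_openLayersCore 5 (by norm_num) (openLayersCore_five_of_sevenFiveLayersCore h) hc

/-- **Level `4` is closed**: `OpenLayers 4` is a theorem (the `(6, 4)` chain). -/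
theorem openLayers_four : OpenLayers 4 :=
  (perFlatResidueBelowFlat_iff_openLayers (by norm_num)).1
    (residueBelowFlat_four_of_typeThree typeThreeSmall_holds twentyOnePrime_holds)

/-- **Level `4` is closed on the core as well**: `OpenLayersCore 4`. -/
theorem openLayersCore_four : OpenLayersCore 4 :=
  openLayersCore_of_openLayers openLayers_four

end PercRepro.GenQ
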